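import Summits.HodgeConjecture.Ring2.CaseEA1Closed
import Literature.AlgebraicGeometry.HodgeTheory.SimpleOddPrimeDimensionHodgeClasses
import Literature.AlgebraicGeometry.HodgeTheory.RibetTypeTwoThreePowersHodgeClasses
import HarnessLib

/-!
# Ring 2 (cell topic `Summits/HodgeConjecture/Ring2/`; seat `lit`, gen 66, R42): the fivefold fact `MoonenZarhin1999_codimTwoHodgeClasses_abelianFivefold` is EQUIVALENT to TWO Hodge-group shapes on SIMPLE fivefolds — `End⁰ = ℚ` (symplectic, `Sp₁₀`) and `End⁰ = k` imaginary quadratic with multiplicities `(2,3)` (unitary) —, FOLLOWS from Ribet 1983 Thms. 1 and 3, and `HCUpToDim 5` modulo Markman and Ribet is the row-four residual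

HONEST FRAMING (cell `pub-hodge-ring2`, verbatim): research route conditional on HC_CM; not a corollary;
Q11.4-sentence-2 already refuted in dim ≥ 3. `HC_CM` does NOT occur in this file. Markman's theorem
(`Markman2025_weilClasses_algebraic_abelianFourfold`) and Ribet's Theorems 1 and 3
(`Ribet1983_hodgeClasses_divisorial_powers_totallyRealField_oddRelDim`,
`Ribet1983_hodgeClasses_divisorial_powers_imaginaryQuadraticCoprime`) are HYPOTHESES, never asserted. Theorems only —
no definition, no named fact, no `sorry`. Literature input: `SimpleOddPrimeDimensionHodgeClasses` (lit g66, R42: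
Albert's shapes in odd prime dimension; Tankeev–Ribet from Ribet), `CaseEA1Closed` (R41: the fact ↔ its simple non-CM
instances).

THE PRINT. Moonen–Zarhin 1999 §2 (2.4) (the table by Albert type), Thm. (2.7) (Tankeev–Ribet: «`Hg(X) = Sp_D(V,φ)` and
`B•(Xⁿ) = D•(Xⁿ)`» for simple `X` of prime dimension); Gordon 1999 Thm. 6.3 (Ribet 1983 Thms. 1–3) and Corollary; for a
simple FIVEFOLD not of CM type `End⁰(X)` is `ℚ` [type I(1)], a totally real quintic field [I(5)], or an imaginary
quadratic field `k` acting on `T_{X,0}` with multiplicities `(1,4)` or `(2,3)` [IV(1,·)].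

THIS FILE.
* §1 **`moonenZarhin1999_codimTwoHodgeClasses_abelianFivefold_iff_generic_and_unitaryTwoThree`** — the named fact is
  EQUIVALENT to: (S1) every SIMPLE fivefold with `End⁰(X) = ℚ` satisfies `B² ⊆ D² + Σ_α α^* B²(X')`, AND (S2) every
  simple fivefold with `dim_ℚ End⁰(X) = 2`, `φ ≫ φ = -d` of multiplicities `≥ 2` at both `± i√d` (i.e. `(2,3)`) does;
  the shapes I(5) (`AbelianVariety.isDivisorGenerated_of_isTotallyReal`, Ribet Thm. 0 — proved), IV with multiplicity
  `1` (`AbelianVariety.isDivisorGenerated_of_ribetTypeOne` — proved), the CM fivefolds and all non-simple fivefolds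
  (R41, `CaseEA1Closed`) are theorems.
* §2 **`moonenZarhin1999_codimTwoHodgeClasses_abelianFivefold_of_ribet1983`** — granted Ribet's Thms. 1 and 3 the
  named fact HOLDS (via `tankeevRibet1983_of_ribet1983`).
* §3 **`hcUpToDim_five_iff_rowFour_of_markman_of_ribet1983`** — granted Markman and Ribet's Thms. 1 and 3,
  `HCUpToDim 5 ↔ HC(simple non-CM fourfolds outside Ribet type (3,1) and minimal quaternion type)`.
* §5 (appended, after the Literature lane's UNCONDITIONAL `RibetTypeTwoThreePowersHodgeClasses`): shape (S2) is a
  THEOREM (`isCodimTwoDivisorPullbackGenerated_of_unitaryTwoThree`), so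
  **`moonenZarhin1999_codimTwoHodgeClasses_abelianFivefold_iff_generic`** — THE FIVEFOLD FACT IS EQUIVALENT TO ITS
  INSTANCES AT THE SIMPLE FIVEFOLDS WITH `End⁰ = ℚ` (one Hodge-group shape, `Sp₁₀`) —,
  `isCodimTwoDivisorPullbackGenerated_of_dim_eq_five_of_not_generic` (pointwise, unconditional: every fivefold not
  simple-with-`End⁰ = ℚ` satisfies the predicate) and
  **`moonenZarhin1999_codimTwoHodgeClasses_abelianFivefold_of_ribet1983_totallyReal`** (the fact follows from Ribet's
  Thm. 1 ALONE).
* §6 (appended) **`hcUpToDim_five_iff_rowFour_refined_and_generic_of_markman`** — MODULO MARKMAN ALONE: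
  `HCUpToDim 5 ↔ HC(row four refined) ∧ HC(simple fivefolds with End⁰ = ℚ)` (no Tankeev–Ribet, no Ribet).
* §4 (appended) `hcOnClass_rowFour_iff_rowFour_refined`, **`hcUpToDim_five_iff_rowFour_refined_of_markman_of_ribet1983`**
  — the row-four class may moreover exclude maximal real multiplication (Ribet Thm. 0, proved) and quartic CM type
  `{(1,1),(2,0)}` (MZ99 Thm. 0.2 (4), proved): the same residual list as the codimension-two census of the fourfold fact.

WHAT IS NOT CLAIMED: (S1) (`Hg = Sp₁₀` for the generic simple fivefold — Ribet's Thm. 1 with `E = ℚ`) and (S2)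
(`Hg = U(2,3)` — Ribet's Thm. 3 beyond type one) are NOT proved; Markman is never asserted.

## References
* [MoonenZarhin1999LowDim] B. Moonen, Yu. Zarhin, Math. Ann. 315 (1999) 711–733, Thm. 0.2, §2 (2.4), Thm. (2.7).
* [Gordon1997] B. B. Gordon, *A survey of the Hodge conjecture for abelian varieties*, Thm. 6.3 and Corollary, §1.13.3.
* [Ribet1983] K. A. Ribet, Amer. J. Math. 105 (1983), Thms. 0–3.
* [Tankeev1983] S. G. Tankeev, Math. USSR-Izv. 20 (1983).
* [MumfordAV1970] D. Mumford, *Abelian Varieties* (1970), §19 Cor. 2, §21 (pp. 201–202).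
* [Deligne2000] P. Deligne, *The Hodge conjecture* (Clay problem description, 2000), §1.
* [claim: Markman2025SurveySecant, status: under-review] E. Markman, arXiv:2509.23403, Thm. 1.2.
-/

noncomputable section

open CategoryTheory CategoryTheory.Limits

namespace Summit.HodgeConjecture.Ring2.FivefoldFactTwoShapes

open Literature.AlgebraicGeometry.Motives (AbelianVariety)
open Literature.AlgebraicGeometry.Motives.AbelianVariety
open Literature.AlgebraicGeometry.HodgeTheory
open Literature.AlgebraicGeometry.ComplexMultiplication
open Literature.AlgebraicGeometry.Milne1999
open NumberField
open Literature.NumberTheory.Automorphic (IsQuaternionAlgebra)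
open Summit.HodgeConjecture.HodgeConjecture.Ring2.ClassTargets
open Summit.HodgeConjecture.Ring2.CaseEA1

variable {X : AbelianVariety ℂ}

/-! ### §1 The fact is two Hodge-group shapes on simple fivefolds -/

/-- `5` is prime and odd. [folklore] -/
private theorem prime_five_and_odd : (5 : ℕ).Prime ∧ Odd 5 := ⟨by norm_num, by decide⟩

/-- **A SIMPLE NON-CM FIVEFOLD OUTSIDE THE TWO RESIDUAL SHAPES HAS `B² ⊆ D²`** — pointwise: given (S1) for this `X` if
`End⁰(X) = ℚ` and (S2) for this `X` if `End⁰(X) = ℚ(φ)` acts with multiplicities `≥ 2`, the predicate holds; shapes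
I(5) and type one are theorems, shape IV(5) is CM type. [cite: MoonenZarhin1999LowDim, §2 (2.4) and Thm. (2.7)]
[cite: Gordon1997, Thm. 6.3 and Corollary] [cite: Ribet1983, Thms. 0 and 3] -/
theorem isCodimTwoDivisorPullbackGenerated_of_isSimple_of_not_isOfCMType_of_shapes (hX5 : X.dim = 5)
    (hs : X.IsSimple) (hcm : ¬ IsOfCMType X)
    (h1 : Module.finrank ℚ X.endAlgebra = 1 → IsCodimTwoDivisorPullbackGenerated X)
    (h2 : ∀ (φ : X ⟶ X) (d : ℕ), 0 < d → φ ≫ φ = -(d • 𝟙 X) → Module.finrank ℚ X.endAlgebra = 2 →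
      2 ≤ eigenMultiplicity X φ (Complex.I * (Real.sqrt d : ℂ)) →
      2 ≤ eigenMultiplicity X φ (-(Complex.I * (Real.sqrt d : ℂ))) → IsCodimTwoDivisorPullbackGenerated X) :
    IsCodimTwoDivisorPullbackGenerated X := by
  classical
  have hp : X.dim.Prime := hX5 ▸ prime_five_and_odd.1
  have hodd : Odd X.dim := hX5 ▸ prime_five_and_odd.2
  have h0 : 0 < X.dim := by omega
  have hF : IsField X.endAlgebra := isField_endAlgebra_of_isSimple_of_prime_of_odd hs hp hodd
  rcases endAlgebra_shape_of_isSimple_of_prime_of_odd hs hp hodd hF with he1 | ⟨heP, hT⟩ | ⟨he2, hnT⟩ | ⟨-, hcm'⟩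
  · exact h1 he1
  · haveI := hT
    exact (AbelianVariety.isDivisorGenerated_of_isTotallyReal X hF heP).isCodimTwoDivisorPullbackGenerated
  · obtain ⟨a, q, hq, ha⟩ := AbelianVariety.exists_mul_self_eq_neg_of_finrank_eq_two h0 he2 hF hnT
    obtain ⟨φ, d, hd, hφ⟩ := AbelianVariety.exists_hom_comp_self_eq_neg X hq ha
    obtain ⟨hpos₁, hpos₂⟩ := AbelianVariety.eigenMultiplicity_pos_of_isSimple X hs φ hd hφ (by omega)
    by_cases hone : eigenMultiplicity X φ (Complex.I * (Real.sqrt d : ℂ)) = 1 ∨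
        eigenMultiplicity X φ (-(Complex.I * (Real.sqrt d : ℂ))) = 1
    · exact (AbelianVariety.isDivisorGenerated_of_ribetTypeOne X φ hd hφ he2 hone (by omega)).isCodimTwoDivisorPullbackGenerated
    · simp only [not_or] at hone
      exact h2 φ d hd hφ he2 (by omega) (by omega)
  · exact absurd hcm' hcm

/-- **LOCALISATION OF THE NAMED FACT TO TWO SHAPES.** `MoonenZarhin1999_codimTwoHodgeClasses_abelianFivefold` is
EQUIVALENT to its instances at (S1) the SIMPLE fivefolds with `End⁰(X) = ℚ` (type I(1): `Hg = Sp₁₀` in print) and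
(S2) the simple fivefolds with `End⁰(X) = ℚ(φ)`, `φ ≫ φ = -d`, acting on `H^{1,0}` with multiplicities `≥ 2` at
both `± i√d` (type IV(1,·) with `(2,3)`: `Hg = U_k` in print, Ribet's Thm. 3). Everything else — the non-simple and
the CM fivefolds (R41), the totally real quintic and the type-one unitary simple fivefolds (Ribet Thms. 0, 3 for
`(m,1)`, proved) — is a theorem of the tree. [cite: MoonenZarhin1999LowDim, Thm. 0.2, §2 (2.4) and Thm. (2.7)]
[cite: Gordon1997, Thm. 6.3 and Corollary] -/
theorem moonenZarhin1999_codimTwoHodgeClasses_abelianFivefold_iff_generic_and_unitaryTwoThree :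
    MoonenZarhin1999_codimTwoHodgeClasses_abelianFivefold ↔
      (∀ X : AbelianVariety ℂ, X.dim = 5 → X.IsSimple → Module.finrank ℚ X.endAlgebra = 1 →
        IsCodimTwoDivisorPullbackGenerated X) ∧
      (∀ (X : AbelianVariety ℂ) (φ : X ⟶ X) (d : ℕ), X.dim = 5 → X.IsSimple → 0 < d → φ ≫ φ = -(d • 𝟙 X) →
        Module.finrank ℚ X.endAlgebra = 2 → 2 ≤ eigenMultiplicity X φ (Complex.I * (Real.sqrt d : ℂ)) →
        2 ≤ eigenMultiplicity X φ (-(Complex.I * (Real.sqrt d : ℂ))) → IsCodimTwoDivisorPullbackGenerated X) := by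
  refine ⟨fun h => ⟨fun X hX _ _ => moonenZarhin1999_codimTwoHodgeClasses_abelianFivefold_iff.1 h X hX,
    fun X φ d hX _ _ _ _ _ _ => moonenZarhin1999_codimTwoHodgeClasses_abelianFivefold_iff.1 h X hX⟩, fun ⟨hS1, hS2⟩ => ?_⟩
  rw [moonenZarhin1999_codimTwoHodgeClasses_abelianFivefold_iff_simple_not_isOfCMType]
  intro X hX hs hcm
  exact isCodimTwoDivisorPullbackGenerated_of_isSimple_of_not_isOfCMType_of_shapes hX hs hcm (hS1 X hX hs)
    (fun φ d hd hφ he2 ha hb => hS2 X φ d hX hs hd hφ he2 ha hb)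

/-! ### §2 The fact from Ribet 1983 -/

/-- **THE FIVEFOLD FACT FOLLOWS FROM RIBET 1983 Thms. 1 AND 3** (named facts of the tree, HYPOTHESES — not discharged):
Tankeev–Ribet follows from them (`tankeevRibet1983_of_ribet1983`, lit g66 R42) and the fact from Tankeev–Ribet
(`CaseEA1.moonenZarhin1999_codimTwoHodgeClasses_abelianFivefold_of_tankeevRibet`, R41).
[cite: MoonenZarhin1999LowDim, Thm. 0.2 and §2 Thm. (2.7)] [cite: Gordon1997, Thm. 6.3 and Corollary] [cite: Ribet1983, Thms. 1 and 3] -/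
theorem moonenZarhin1999_codimTwoHodgeClasses_abelianFivefold_of_ribet1983
    (hR1 : Ribet1983_hodgeClasses_divisorial_powers_totallyRealField_oddRelDim)
    (hR3 : Ribet1983_hodgeClasses_divisorial_powers_imaginaryQuadraticCoprime) :
    MoonenZarhin1999_codimTwoHodgeClasses_abelianFivefold :=
  moonenZarhin1999_codimTwoHodgeClasses_abelianFivefold_of_tankeevRibet (tankeevRibet1983_of_ribet1983 hR1 hR3)

/-! ### §3 The HC axis modulo Markman and Ribet -/

/-- **`HCUpToDim 5` MODULO MARKMAN AND RIBET 1983 IS THE ROW-FOUR RESIDUAL**: granted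
`Markman2025_weilClasses_algebraic_abelianFourfold` and Ribet's Thms. 1 and 3 (hypotheses), the Hodge conjecture for
all complex abelian varieties of dimension `≤ 5` is EQUIVALENT to the Hodge conjecture on the simple fourfolds not of
CM type, neither of Ribet type `(3,1)` over `k = End⁰` nor of minimal quaternion type.
[cite: MoonenZarhin1999LowDim, Thm. 0.1, Thm. 0.2 and §2 Thm. (2.7)] [cite: Gordon1997, Thm. 6.3 and Corollary]
[claim: Markman2025SurveySecant, status: under-review] -/
theorem hcUpToDim_five_iff_rowFour_of_markman_of_ribet1983
    (hMark : Markman2025_weilClasses_algebraic_abelianFourfold)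
    (hR1 : Ribet1983_hodgeClasses_divisorial_powers_totallyRealField_oddRelDim)
    (hR3 : Ribet1983_hodgeClasses_divisorial_powers_imaginaryQuadraticCoprime) :
    HCUpToDim 5 ↔ (HCOnClass fun A => A.dim = 4 ∧ A.IsSimple ∧ ¬ IsOfCMType A ∧
      (¬ ∃ (φ : A ⟶ A) (d : ℕ), 0 < d ∧ φ ≫ φ = -(d • 𝟙 A) ∧ Module.finrank ℚ A.endAlgebra = 2 ∧
        (eigenMultiplicity A φ (Complex.I * (Real.sqrt d : ℂ)) = 1 ∨
          eigenMultiplicity A φ (-(Complex.I * (Real.sqrt d : ℂ))) = 1)) ∧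
      (¬ ∃ (K : Type) (_ : Field K) (_ : NumberField K) (_ : IsTotallyReal K) (_ : Algebra K A.endAlgebra)
        (_ : IsScalarTower ℚ K A.endAlgebra) (_ : IsQuaternionAlgebra K A.endAlgebra), A.dim = 2 * Module.finrank ℚ K)) :=
  hcUpToDim_five_iff_rowFour_of_markman_of_tankeevRibet hMark (tankeevRibet1983_of_ribet1983 hR1 hR3)

/-! ### §4 Row four refined twice (appended): maximal real multiplication and quartic CM type `{(1,1),(2,0)}` are theorems -/

/-- **THE ROW-FOUR RESIDUAL, REFINED**: `HC` on the simple non-CM fourfolds outside Ribet type `(3,1)` and minimal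
quaternion type is EQUIVALENT to `HC` on those that are moreover NOT of maximal real-multiplication type (`End⁰(A)` a
totally real quartic field — `B = D`, Ribet's Thm. 0, the tree's `hodgeConjectureFor_powSucc_of_isTotallyReal_finrank_eq_dim`)
and NOT of quartic CM type `{(1,1),(2,0)}` (`B = D`, MZ99 Thm. 0.2 (4), the tree's `hodgeConjectureFor_of_quarticCM`) —
what is left of Moonen–Zarhin 1995: types I(1), I(2), II, III over `ℚ`, IV(1,1) of signature `(2,2)`, IV(2,1) `⊇ k` of
signature `(2,2)`, IV with `d = 2` (the same list as the codimension-two residual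
`NonSimpleFourfoldsCodimTwo.moonenZarhin1999_codimTwoHodgeClasses_abelianFourfold_iff_residual''`).
[cite: MoonenZarhin1999LowDim, Thm. 0.1, Thm. 0.2 (4) and §2 (2.2)–(2.4)] [cite: MoonenZarhin1995Duke, Thm. 2.4] [cite: Ribet1983, Thms. 0 and 3] -/
theorem hcOnClass_rowFour_iff_rowFour_refined :
    (HCOnClass fun A => A.dim = 4 ∧ A.IsSimple ∧ ¬ IsOfCMType A ∧
      (¬ ∃ (φ : A ⟶ A) (d : ℕ), 0 < d ∧ φ ≫ φ = -(d • 𝟙 A) ∧ Module.finrank ℚ A.endAlgebra = 2 ∧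
        (eigenMultiplicity A φ (Complex.I * (Real.sqrt d : ℂ)) = 1 ∨
          eigenMultiplicity A φ (-(Complex.I * (Real.sqrt d : ℂ))) = 1)) ∧
      (¬ ∃ (K : Type) (_ : Field K) (_ : NumberField K) (_ : IsTotallyReal K) (_ : Algebra K A.endAlgebra)
        (_ : IsScalarTower ℚ K A.endAlgebra) (_ : IsQuaternionAlgebra K A.endAlgebra), A.dim = 2 * Module.finrank ℚ K)) ↔
    HCOnClass fun A => A.dim = 4 ∧ A.IsSimple ∧ ¬ IsOfCMType A ∧
      (¬ ∃ (φ : A ⟶ A) (d : ℕ), 0 < d ∧ φ ≫ φ = -(d • 𝟙 A) ∧ Module.finrank ℚ A.endAlgebra = 2 ∧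
        (eigenMultiplicity A φ (Complex.I * (Real.sqrt d : ℂ)) = 1 ∨
          eigenMultiplicity A φ (-(Complex.I * (Real.sqrt d : ℂ))) = 1)) ∧
      (¬ ∃ (K : Type) (_ : Field K) (_ : NumberField K) (_ : IsTotallyReal K) (_ : Algebra K A.endAlgebra)
        (_ : IsScalarTower ℚ K A.endAlgebra) (_ : IsQuaternionAlgebra K A.endAlgebra), A.dim = 2 * Module.finrank ℚ K) ∧
      (¬ ∃ hF : IsField A.endAlgebra, IsTotallyReal (EndField A hF) ∧ Module.finrank ℚ A.endAlgebra = A.dim) ∧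
      (¬ ∃ (φ : A ⟶ A) (μ₁ μ₂ : ℂ), Module.finrank ℚ A.endAlgebra = 4 ∧ starRingEnd ℂ μ₁ ≠ μ₁ ∧
        starRingEnd ℂ μ₂ ≠ μ₂ ∧ μ₂ ≠ μ₁ ∧ μ₂ ≠ starRingEnd ℂ μ₁ ∧ eigenMultiplicity A φ μ₁ = 1 ∧
        eigenMultiplicity A φ (starRingEnd ℂ μ₁) = 1 ∧ eigenMultiplicity A φ μ₂ = 2) := by
  refine ⟨fun h => hcOnClass_mono (fun A hA => ⟨hA.1, hA.2.1, hA.2.2.1, hA.2.2.2.1, hA.2.2.2.2.1⟩) h,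
    fun h A hA => ?_⟩
  obtain ⟨hA4, hs, hcm, hR, hQ⟩ := hA
  by_cases hT : ∃ hF : IsField A.endAlgebra, IsTotallyReal (EndField A hF) ∧ Module.finrank ℚ A.endAlgebra = A.dim
  · obtain ⟨hF, hTR, he⟩ := hT
    exact hodgeConjectureFor_powSucc_of_isTotallyReal_finrank_eq_dim A hF hTR he 0
  by_cases hC : ∃ (φ : A ⟶ A) (μ₁ μ₂ : ℂ), Module.finrank ℚ A.endAlgebra = 4 ∧ starRingEnd ℂ μ₁ ≠ μ₁ ∧
      starRingEnd ℂ μ₂ ≠ μ₂ ∧ μ₂ ≠ μ₁ ∧ μ₂ ≠ starRingEnd ℂ μ₁ ∧ eigenMultiplicity A φ μ₁ = 1 ∧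
      eigenMultiplicity A φ (starRingEnd ℂ μ₁) = 1 ∧ eigenMultiplicity A φ μ₂ = 2
  · obtain ⟨φ, μ₁, μ₂, hE4, h11, h22, h12, h12', h1, h1', h2⟩ := hC
    exact hodgeConjectureFor_of_quarticCM A hs φ hE4 h11 h22 h12 h12' h1 h1' h2 hA4
  exact h A ⟨hA4, hs, hcm, hR, hQ, hT, hC⟩

/-- **`HCUpToDim 5` MODULO MARKMAN AND RIBET 1983, FINEST FORM**: granted `Markman2025_weilClasses_algebraic_abelianFourfold`
and Ribet's Thms. 1 and 3 (hypotheses), the Hodge conjecture for all complex abelian varieties of dimension `≤ 5` is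
EQUIVALENT to the Hodge conjecture on the simple non-CM fourfolds of none of the four types: Ribet `(3,1)`, minimal
quaternion, maximal real multiplication, quartic CM `{(1,1),(2,0)}`. [cite: MoonenZarhin1999LowDim, Thm. 0.1, Thm. 0.2 and §2]
[cite: MoonenZarhin1995Duke, Thm. 2.4] [cite: Gordon1997, Thm. 6.3 and Corollary] [claim: Markman2025SurveySecant, status: under-review] -/
theorem hcUpToDim_five_iff_rowFour_refined_of_markman_of_ribet1983
    (hMark : Markman2025_weilClasses_algebraic_abelianFourfold)
    (hR1 : Ribet1983_hodgeClasses_divisorial_powers_totallyRealField_oddRelDim)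
    (hR3 : Ribet1983_hodgeClasses_divisorial_powers_imaginaryQuadraticCoprime) :
    HCUpToDim 5 ↔ HCOnClass fun A => A.dim = 4 ∧ A.IsSimple ∧ ¬ IsOfCMType A ∧
      (¬ ∃ (φ : A ⟶ A) (d : ℕ), 0 < d ∧ φ ≫ φ = -(d • 𝟙 A) ∧ Module.finrank ℚ A.endAlgebra = 2 ∧
        (eigenMultiplicity A φ (Complex.I * (Real.sqrt d : ℂ)) = 1 ∨
          eigenMultiplicity A φ (-(Complex.I * (Real.sqrt d : ℂ))) = 1)) ∧
      (¬ ∃ (K : Type) (_ : Field K) (_ : NumberField K) (_ : IsTotallyReal K) (_ : Algebra K A.endAlgebra)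
        (_ : IsScalarTower ℚ K A.endAlgebra) (_ : IsQuaternionAlgebra K A.endAlgebra), A.dim = 2 * Module.finrank ℚ K) ∧
      (¬ ∃ hF : IsField A.endAlgebra, IsTotallyReal (EndField A hF) ∧ Module.finrank ℚ A.endAlgebra = A.dim) ∧
      (¬ ∃ (φ : A ⟶ A) (μ₁ μ₂ : ℂ), Module.finrank ℚ A.endAlgebra = 4 ∧ starRingEnd ℂ μ₁ ≠ μ₁ ∧
        starRingEnd ℂ μ₂ ≠ μ₂ ∧ μ₂ ≠ μ₁ ∧ μ₂ ≠ starRingEnd ℂ μ₁ ∧ eigenMultiplicity A φ μ₁ = 1 ∧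
        eigenMultiplicity A φ (starRingEnd ℂ μ₁) = 1 ∧ eigenMultiplicity A φ μ₂ = 2) := by
  rw [hcUpToDim_five_iff_rowFour_of_markman_of_ribet1983 hMark hR1 hR3, hcOnClass_rowFour_iff_rowFour_refined]

/-! ### §5 (appended) Shape (S2) DISCHARGED: the fivefold fact is the single generic shape `End⁰ = ℚ` -/

/-- **Shape (S2) is a theorem**: a complex abelian FIVEFOLD with `φ ≫ φ = -d`, `dim_ℚ End⁰ = 2` and both
multiplicities `≥ 2` (type IV(1) with `(2,3)`) satisfies `B² ⊆ D² + Σ α^* B²(X')` — indeed `B = D` on all its powers,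
the Literature lane's UNCONDITIONAL `AbelianVariety.isDivisorGenerated_of_ribetTypeTwoThree` (Ribet 1983 Thm. 3 at
`(2,3)`, via THEOREM L″ and the classification-free `Θ`-subalgebra theorem `UnitaryThetaCore.eq_top_two_three'`).
[cite: Ribet1983, Thm. 3] [cite: MoonenZarhin1999LowDim, §2 (2.4) and Thm. (2.7)] -/
theorem isCodimTwoDivisorPullbackGenerated_of_unitaryTwoThree (hX5 : X.dim = 5) (φ : X ⟶ X) {d : ℕ} (hd : 0 < d)
    (hφ : φ ≫ φ = -(d • 𝟙 X)) (he2 : Module.finrank ℚ X.endAlgebra = 2)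
    (h2a : 2 ≤ eigenMultiplicity X φ (Complex.I * (Real.sqrt d : ℂ)))
    (h2b : 2 ≤ eigenMultiplicity X φ (-(Complex.I * (Real.sqrt d : ℂ)))) : IsCodimTwoDivisorPullbackGenerated X :=
  (AbelianVariety.isDivisorGenerated_of_ribetTypeTwoThree X φ hd hφ he2 h2a h2b hX5).isCodimTwoDivisorPullbackGenerated

/-- **LOCALISATION OF THE NAMED FACT TO ONE SHAPE.** `MoonenZarhin1999_codimTwoHodgeClasses_abelianFivefold` is
EQUIVALENT to its instances at the SIMPLE fivefolds with `End⁰(X) = ℚ` (type I(1); in print `Hg = Sp₁₀`, Ribet's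
Thm. 1 with `E = ℚ`, `g = 5` / Moonen–Zarhin p. 715). Every other fivefold — non-simple, CM, totally real quintic
`End⁰`, type IV(1) with multiplicities `(1,4)` OR `(2,3)` — is a theorem of the tree.
[cite: MoonenZarhin1999LowDim, Thm. 0.2, §2 (2.4) and Thm. (2.7)] [cite: Gordon1997, Thm. 6.3 and Corollary] [cite: Ribet1983, Thms. 0–3] -/
theorem moonenZarhin1999_codimTwoHodgeClasses_abelianFivefold_iff_generic :
    MoonenZarhin1999_codimTwoHodgeClasses_abelianFivefold ↔
      ∀ X : AbelianVariety ℂ, X.dim = 5 → X.IsSimple → Module.finrank ℚ X.endAlgebra = 1 →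
        IsCodimTwoDivisorPullbackGenerated X := by
  rw [moonenZarhin1999_codimTwoHodgeClasses_abelianFivefold_iff_generic_and_unitaryTwoThree]
  exact ⟨fun h => h.1, fun h => ⟨h, fun X φ d hX _ hd hφ he2 ha hb =>
    isCodimTwoDivisorPullbackGenerated_of_unitaryTwoThree hX φ hd hφ he2 ha hb⟩⟩

/-- **POINTWISE and UNCONDITIONAL**: every complex abelian fivefold that is NOT simple with `End⁰ = ℚ` satisfies
`B² ⊆ D² + Σ_α α^* B²(X')`. [cite: MoonenZarhin1999LowDim, Thm. 0.2 and §2] [cite: Ribet1983, Thms. 0–3] -/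
theorem isCodimTwoDivisorPullbackGenerated_of_dim_eq_five_of_not_generic (hX5 : X.dim = 5)
    (h : X.IsSimple → Module.finrank ℚ X.endAlgebra ≠ 1) : IsCodimTwoDivisorPullbackGenerated X := by
  by_cases hs : X.IsSimple
  · by_cases hcm : IsOfCMType X
    · exact isCodimTwoDivisorPullbackGenerated_of_dim_eq_five_of_isSimple_imp_isOfCMType hX5 fun _ => hcm
    · exact isCodimTwoDivisorPullbackGenerated_of_isSimple_of_not_isOfCMType_of_shapes hX5 hs hcm
        (fun h1 => absurd h1 (h hs))
        (fun φ d hd hφ he2 ha hb => isCodimTwoDivisorPullbackGenerated_of_unitaryTwoThree hX5 φ hd hφ he2 ha hb)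
  · exact isCodimTwoDivisorPullbackGenerated_of_dim_eq_five_of_isSimple_imp_isOfCMType hX5 fun h' => absurd h' hs

/-- **THE FIVEFOLD FACT FROM RIBET 1983 Thm. 1 ALONE** (named fact of the tree, HYPOTHESIS): the remaining shape
`End⁰ = ℚ` is a totally real field of odd relative dimension `5`. [cite: Ribet1983, Thm. 1] [cite: Gordon1997, Thm. 6.3 (1) and Corollary]
[cite: MoonenZarhin1999LowDim, Thm. 0.2 and Thm. (2.7)] -/
theorem moonenZarhin1999_codimTwoHodgeClasses_abelianFivefold_of_ribet1983_totallyReal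
    (hR1 : Ribet1983_hodgeClasses_divisorial_powers_totallyRealField_oddRelDim) :
    MoonenZarhin1999_codimTwoHodgeClasses_abelianFivefold := by
  rw [moonenZarhin1999_codimTwoHodgeClasses_abelianFivefold_iff_generic]
  intro X hX5 hs h1
  have hp : X.dim.Prime := hX5 ▸ prime_five_and_odd.1
  have hodd : Odd X.dim := hX5 ▸ prime_five_and_odd.2
  have h0 : 0 < X.dim := by omega
  have hF : IsField X.endAlgebra := isField_endAlgebra_of_isSimple_of_prime_of_odd hs hp hodd
  have hT : IsTotallyReal (EndField X hF) := by
    rcases isTotallyReal_or_isCMField_endField_of_isSimple X hs h0 hF with hT | hCM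
    · exact hT
    · exfalso
      haveI := hCM
      have heven : Module.finrank ℚ (EndField X hF) = 2 * InfinitePlace.nrComplexPlaces (EndField X hF) :=
        IsTotallyComplex.finrank (EndField X hF)
      rw [EndField.finrank_eq hF, h1] at heven
      omega
  exact (isDivisorGenerated_powSucc_of_ribet1983_totallyReal hR1 X hF hT (r := X.dim) (by rw [h1, one_mul]) hodd
    0).isCodimTwoDivisorPullbackGenerated

/-! ### §6 (appended) The HC axis modulo MARKMAN ALONE: row four refined and the generic simple fivefolds -/

/-- **`HCUpToDim 5` MODULO MARKMAN'S FOURFOLD THEOREM ALONE** (hypothesis; no Tankeev–Ribet, no Ribet): the Hodge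
conjecture for all complex abelian varieties of dimension `≤ 5` is EQUIVALENT to the Hodge conjecture on
(α) the simple non-CM fourfolds of none of the four types (Ribet `(3,1)`, minimal quaternion, maximal real
multiplication, quartic CM `{(1,1),(2,0)}`) [the rest of Moonen–Zarhin 1995] AND (β) the SIMPLE FIVEFOLDS WITH
`End⁰ = ℚ` [the generic shape, `Hg = Sp₁₀` in print]: every other simple fivefold has `B = D` on all its powers
UNCONDITIONALLY (`hodgeConjectureFor_powSucc_of_isSimple_fivefold_of_finrank_ne_one`, lit g66 R43), CM fivefolds by
Pohlmann, case (g) and case (e) ∩ (a1) by the cell's closures (`hcOnClass_caseG13_of_caseGQuartic`,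
`hcOnClass_caseGQuartic_of_caseE`, `hcOnClass_caseE_of_markman`).
[cite: MoonenZarhin1999LowDim, Thm. 0.1, Thm. 0.2 and §2 Thm. (2.7)] [cite: MoonenZarhin1995Duke, Thm. 2.4] [cite: Ribet1983, Thms. 0–3]
[claim: Markman2025SurveySecant, status: under-review] -/
theorem hcUpToDim_five_iff_rowFour_refined_and_generic_of_markman
    (hMark : Markman2025_weilClasses_algebraic_abelianFourfold) :
    HCUpToDim 5 ↔ (HCOnClass fun A => A.dim = 4 ∧ A.IsSimple ∧ ¬ IsOfCMType A ∧
      (¬ ∃ (φ : A ⟶ A) (d : ℕ), 0 < d ∧ φ ≫ φ = -(d • 𝟙 A) ∧ Module.finrank ℚ A.endAlgebra = 2 ∧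
        (eigenMultiplicity A φ (Complex.I * (Real.sqrt d : ℂ)) = 1 ∨
          eigenMultiplicity A φ (-(Complex.I * (Real.sqrt d : ℂ))) = 1)) ∧
      (¬ ∃ (K : Type) (_ : Field K) (_ : NumberField K) (_ : IsTotallyReal K) (_ : Algebra K A.endAlgebra)
        (_ : IsScalarTower ℚ K A.endAlgebra) (_ : IsQuaternionAlgebra K A.endAlgebra), A.dim = 2 * Module.finrank ℚ K) ∧
      (¬ ∃ hF : IsField A.endAlgebra, IsTotallyReal (EndField A hF) ∧ Module.finrank ℚ A.endAlgebra = A.dim) ∧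
      (¬ ∃ (φ : A ⟶ A) (μ₁ μ₂ : ℂ), Module.finrank ℚ A.endAlgebra = 4 ∧ starRingEnd ℂ μ₁ ≠ μ₁ ∧
        starRingEnd ℂ μ₂ ≠ μ₂ ∧ μ₂ ≠ μ₁ ∧ μ₂ ≠ starRingEnd ℂ μ₁ ∧ eigenMultiplicity A φ μ₁ = 1 ∧
        eigenMultiplicity A φ (starRingEnd ℂ μ₁) = 1 ∧ eigenMultiplicity A φ μ₂ = 2)) ∧
      HCOnClass fun A => A.dim = 5 ∧ A.IsSimple ∧ Module.finrank ℚ A.endAlgebra = 1 := by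
  rw [Summit.HodgeConjecture.Ring2.LowDimOfMarkman.hcUpToDim_five_iff_caseG_of_markman hMark,
    ← hcOnClass_rowFour_iff_rowFour_refined,
    ← Summit.HodgeConjecture.Ring2.LowDimOfMarkman.hcAtDim_four_iff_of_markman' hMark,
    Summit.HodgeConjecture.Ring2.LowDimOfMarkman.hcAtDim_four_iff_simple_nonCM_of_markman hMark]
  refine and_congr_right fun _ => ⟨fun h A hA => ?_, fun h A hA => ?_⟩
  · -- a generic simple fivefold: CM ones are unconditional, the others are in the big class
    obtain ⟨hA5, hs, _⟩ := hA
    by_cases hcm : IsOfCMType A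
    · exact hodgeConjectureFor_of_isDivisorGenerated _
        (Literature.AlgebraicGeometry.Pohlmann1968.isDivisorGenerated_powSucc_of_isSimple_of_isOfCMType_of_prime A
          prime_five_and_odd.1 hA5 hs hcm 0)
    · exact h A ⟨hA5, Or.inl ⟨hs, hcm⟩⟩
  · obtain ⟨hA5, hcases⟩ := hA
    rcases hcases with ⟨hs, hcm⟩ | hrest
    · by_cases h1 : Module.finrank ℚ A.endAlgebra = 1
      · exact h A ⟨hA5, hs, h1⟩
      · exact hodgeConjectureFor_powSucc_of_isSimple_fivefold_of_finrank_ne_one hs hA5 h1 0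
    · -- case (g) (with `≠`, i.e. multiplicities `(1,3)`) and case (e) ∩ (a1): closed granted Markman
      have hGE := Summit.HodgeConjecture.Ring2.LowDimOfMarkman.hcOnClass_caseG13_of_caseGQuartic
        (Summit.HodgeConjecture.Ring2.CaseGQuarticField.hcOnClass_caseGQuartic_of_caseE (hcOnClass_caseE_of_markman hMark))
      refine hGE A ⟨hA5, ?_⟩
      rcases hrest with ⟨C, F, χ, d', φ, M, hC, hd', hχ, hFs, hF4, hFcm, hM, hφ, hz, hne, hiso⟩ | he
      · exact Or.inl ⟨C, F, χ, d', φ, M, hC, hd', hχ, hFs, hF4, hFcm, hM, hφ, hz,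
          Summit.HodgeConjecture.Ring2.LowDimOfMarkman.eigenMultiplicity_eq_one_or_eq_one_of_isSimple_of_dim_eq_four
            hFs hF4 φ (Nat.mul_pos (Nat.mul_pos hM hM) hd') hφ hne, hiso⟩
      · exact Or.inr he

/-- **On path**: the class of simple fivefolds of generic shape is a case of the summit. [cite: Deligne2000, §1] -/
theorem genericSimpleFivefolds_hcOnClass_of_hodgeConjecture (h : _root_.HodgeConjecture) :
    HCOnClass fun A => A.dim = 5 ∧ A.IsSimple ∧ Module.finrank ℚ A.endAlgebra = 1 :=
  hcOnClass_of_hodgeConjecture _ h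

end Summit.HodgeConjecture.Ring2.FivefoldFactTwoShapes

end
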